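import Summits.KontsevichZagierPeriods.KontsevichZagierPeriods.Theses.LowDimension
import Literature.NumberTheory.Transcendental.KZLogCalculusProofs
import Literature.NumberTheory.Transcendental.KZRulesAssociator
import Summits.KontsevichZagierPeriods.KontsevichZagierPeriods.Theorems.ReducedPeriodRing.Negative.DimZero
import Summits.KontsevichZagierPeriods.KontsevichZagierPeriods.Theorems.TerasomaMultiplicationBetaCancellationPiSectors

/-!
# `LowdimDimZero` (stmt-KontsevichZagierPeriods-0119) — Conjecture 1 in dimension `0`

Closing file for the dimension-`0` layer of Kontsevich–Zagier's Conjecture 1 (route LowDimension,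
item 0119): two `0`-dimensional integral representations with the same value are KZ-equivalent.
No transcendence input: `Set (Fin 0 → ℝ) = {∅, univ}`, the value of `[pt, f]` is `f pt`
(`vol ℝ⁰ = 1`, REUSED tree lemma `ReducedPeriodRingNegative.value_eq_integrand_default`) and the
value over `∅` is `0`. If the common value is `0` both representations are relations (REUSED tree
lemma `BetaCancellationLine.of_mem_relations_of_dim_zero_of_value_eq_zero`); otherwise both domains
are the point and the integrands agree there, so the two representations are congruent (rule (1b)
with a zero representation, `KZ.of_sub_of_mem_relations_of_eqOn`). Prepared by the lead seat c5 of
crux stmt-KontsevichZagierPeriods-3869 (line SketchIdeator1).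

Sources: M. Kontsevich, D. Zagier, *Periods* (2001), §1.1 (ℝ⁰ is a point of volume 1), §1.2 rule (1).
No definitions are introduced.
-/

noncomputable section

open MeasureTheory Set
open Literature.NumberTheory.Transcendental Literature.NumberTheory.Transcendental.KZ
open Summit.KontsevichZagierPeriods.KontsevichZagierPeriods.ReducedPeriodRingNegative
  (value_eq_integrand_default)
open Summit.KontsevichZagierPeriods.KontsevichZagierPeriods.BetaCancellationLine
  (of_mem_relations_of_dim_zero_of_value_eq_zero)

namespace Summit.KontsevichZagierPeriods.LowDimension.LowdimDimZero

/-- A `0`-dimensional representation of non-zero value has domain the point: the only other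
subset of `ℝ⁰` is `∅`, over which the value is `0`. [cite: KontsevichZagier2001, §1.1] -/
theorem domain_eq_univ_of_value_ne_zero (r : IntegralRep 0) (h : r.value ≠ 0) : r.domain = univ := by
  rcases Set.eq_empty_or_nonempty r.domain with hd | hd
  · exact absurd (by rw [IntegralRep.value, hd]; simp) h
  · exact Subsingleton.eq_univ_of_nonempty hd

/-- **Kontsevich–Zagier's Conjecture 1 in dimension `0`** (item stmt-KontsevichZagierPeriods-0119):
two `0`-dimensional integral representations with equal values are KZ-equivalent.
[cite: KontsevichZagier2001, §1.2 Conjecture 1] -/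
theorem lowdimDimZero_proof :
    Summit.KontsevichZagierPeriods.KontsevichZagierPeriods.Theses.LowDimension.LowdimDimZero := by
  intro r r' hv
  show of r - of r' ∈ relations
  by_cases h0 : r.value = 0
  · exact relations.sub_mem (of_mem_relations_of_dim_zero_of_value_eq_zero r h0)
      (of_mem_relations_of_dim_zero_of_value_eq_zero r' (hv ▸ h0))
  have hd : r.domain = univ := domain_eq_univ_of_value_ne_zero r h0
  have hd' : r'.domain = univ := domain_eq_univ_of_value_ne_zero r' fun h => h0 (hv.trans h)
  refine of_sub_of_mem_relations_of_eqOn (hd'.trans hd.symm) fun x _ => ?_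
  rw [Subsingleton.elim x default, ← value_eq_integrand_default r hd,
    ← value_eq_integrand_default r' hd', hv]

end Summit.KontsevichZagierPeriods.LowDimension.LowdimDimZero

end
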